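import Summits.KontsevichZagierPeriods.KontsevichZagierPeriods.Theses.EulerFormChain
import Summits.KontsevichZagierPeriods.KontsevichZagierPeriods.Theorems.InverseLandauTateLiftingBallPolydisc

/-!
# `BallCalibration` (stmt-KontsevichZagierPeriods-3819, route EulerFormChain) — proof

`2·[B̄₄, 1] − [D̄ × D̄, 1] ∈ KZ.relations` (`vol₄ B̄₄ = π²/2`): the `k = 2` instance of
`Summit.KontsevichZagierPeriods.InverseLandau.ballPolydisc` — the closed unit balls of ALL even dimensions against the
closed polydiscs inside the Kontsevich–Zagier rules (`Theorems/InverseLandauTateLiftingBallPolydisc.lean`, line `Sketch` of crux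
`TateLifting`, stubs 62–65: Lindemann read in the formal period ring + Fubini splitting; no fibrewise scaling needed).
-/

namespace Summit.KontsevichZagierPeriods.EulerFormChain

/-- **`BallCalibration`** (route EulerFormChain, stmt-KontsevichZagierPeriods-3819): for the integrand-`1` representations `b`
over the closed unit ball of `ℝ⁴` and `p` over the closed bidisc `D̄ × D̄ ⊂ ℝ⁴`, `2·[b] − [p] ∈ KZ.relations`.
Proof: `InverseLandau.ballCalibration`. [cite: KontsevichZagier2001, §1.2] -/
theorem ballCalibration_proof :
    Summit.KontsevichZagierPeriods.KontsevichZagierPeriods.Theses.EulerFormChain.BallCalibration :=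
  Summit.KontsevichZagierPeriods.InverseLandau.ballCalibration

end Summit.KontsevichZagierPeriods.EulerFormChain
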